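/-
Origin: written from primary sources — R. Howe, *θ-series and invariant theory* (1979) §3 (restriction of the oscillator
representation of the big pair to the see-saw partner is the tensor of the renormalised small ones); S. Kudla, *Seesaw dual
reductive pairs* (1984) §1 (the see-saw partner of a NON-trivially embedded orthogonal decomposition `W ≅ W₁ ⊕ W₂`, conjugation by
the isometry); S. Gelbart, J. Rogawski, *L-functions and Fourier–Jacobi coefficients for the unitary group U(3)* (1991) §3.1
Prop. 3.1.1 p. 455, Remark p. 457; A. Weil, *Sur certains groupes d'opérateurs unitaires* (1964) Chap. III n° 41 p. 193.
Adapted: no. This file is the sibling of `UnitaryDualPairSeesawCMLines` (`g = 1`, `C = 1`) for a GENERAL rational isometry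
`g₀ : diag(b) ≅ diag(a)` of hermitian planes: the `(34)`-currency see-saw scheme of `UnitaryDualPairSeesawSchemeSmall` /
`…SeesawThetaProduct` / `…SeesawWedgeKType` at the CM diagonal data with `g = g₀ ⊗ 1`, `C = 1 ⊗ diag(bᵢ/aᵢ) ⊗ 1`. Kernel only; no records.
-/
import Literature.NumberTheory.GelbartRogawski1991.UnitaryDualPairSeesawCMLines
import HarnessLib

-- buildfix G11b-3 recipe (LEDGER B13-1/B13-3): elaborate sequentially so the trailing `attribute [implicit_reducible]`
-- block (reducibilityCoreExt is keyed to the async environment branch) is in force at `.olean` export.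
set_option Elab.async false

/-!
# The see-saw restriction of the normalised CM pair representation to a CONJUGATED torus `U(V) × g(U(1) × U(1))g⁻¹`

Data: a CM field `L` (`L⁺ = maximalRealSubfield L`, `c = complexConj`), a diagonal hermitian space `V = diag(dV)` of rank `N`,
a diagonal hermitian PLANE `W = diag(a₀, a₁)` carrying the big dual pair `(U(V), U(W))` and its normalised pair representation
`ω_ψ ∘ (s_pair ⊗ η)` (`cmPairRepTwist … η`, [GelbartRogawski1991, Prop. 3.1.1, Remark p. 457]), and a SECOND diagonal plane
`W′ = diag(b₀, b₁)` ISOMETRIC to `W` through a rational `g₀ ∈ GL₂(L)`, `ᵗḡ₀ · diag(a) · g₀ = diag(b)` (hypothesis `hg₀`).  Then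
`W ⊗ 𝔸 = g(⟨b₀⟩ ⊕ ⟨b₁⟩) ⊗ 𝔸` with `g = g₀ ⊗ 1` an adelic isometry (`adelicIsometry_conj`, `isometry_map` along `L → 𝔸_L`) and the
real Gram matrices are intertwined by `C = 1 ⊗ diag(bᵢ/aᵢ) ⊗ 1` (`gramConj`, `gramIntertwiner_conj`), so the `(34)`-currency
see-saw scheme of `UnitaryDualPairSeesawSchemeSmall` §ThirtyFour applies at these data; the torus of `U(W)(𝔸)` it lands in is the
CONJUGATED torus `(u₀, u₁) ↦ (g₀ ⊗ 1) · diag(u₀, u₁) · (g₀ ⊗ 1)⁻¹` (`cmConjPlaneTorus`, `coe_cmConjPlaneTorus`).  Every statement of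
the sibling file `UnitaryDualPairSeesawCMLines` (the case `g₀ = 1`, `b = a`) is re-proved here at `g₀`, with the same proofs:

* §0 the `(34)` data `g = g₀ ⊗ 1`, `C = 1 ⊗ diag(bᵢ/aᵢ) ⊗ 1` and their four scheme hypotheses `hgg₀ hg hCC₀ hC`;
* §1 `cmConjLineRepRaw₀/₁` = K-1's renormalised `seesawConjRep₁/₂` on `U(V)(𝔸) × U(⟨b_k⟩)(𝔸)`, `cmConjLineTensor = ⊗″`, the
  operator-level see-saw **`cmPairRep_conjBlockDiag_cmConjLineTensor`** [Howe1979, §3; Kudla1984, §1] and the theta product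
  **`thetaDistLM_cmConjLineTensor`** [Weil1964, n° 41 Thm 6];
* §2 the conjugated torus `cmConjPlaneTorus` and the split `cmConjEta₀/₁`, `cmConjEta_torus` of the normalising character;
* §3 the twisted line representations **`cmConjLineRep₀ η₀`, `cmConjLineRep₁ η₁`** on `U(V)(𝔸) × U(1)(𝔸)` (parametric in a split
  `η(v, g·diag(u₀,u₁)·g⁻¹) = η₀(v,u₀) · η₁(v,u₁)`) and **`cmPairRepTwist_conjTorus_cmConjLineTensor`**
  [GelbartRogawski1991, §3.1 Remark p. 457; Howe1979, §3];
* §4 the currencies `𝒮(𝔸^{n₁})` and `ker N_{L/L⁺}` (`cmConjLineTensorFin`, `cmConjLineRepFin₀/₁`, `cmConjPlaneTorusIdeles`,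
  **`cmPairRepTwist_conjTorusIdeles_cmConjLineTensorFin`**, **`thetaDistLM_cmConjLineTensorFin`**);
* §5 rational points act inside the theta stabiliser;
* §6 the junction with the `adelicUnitaryGroup` currency: an `x ∈ U(diag a)(𝔸_{L⁺})` with `x = (g₀ ⊗ 1) · d · (g₀ ⊗ 1)⁻¹`,
  `d = diag(t₀, t₁)`, is carried by `cmAdelicEquiv` to `cmConjPlaneTorusIdeles (t₀, t₁)` (**`cmAdelicEquiv_eq_cmConjPlaneTorusIdeles`**),
  whence **`cmPairRepTwist_cmAdelicEquiv_cmConjLineTensorFin`** and the Θ-value identity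
  **`thetaDistLM_cmPairRepTwist_cmAdelicEquiv_cmConjLineTensorFin`**.

Provenance / use (Hodge-CM model-construction cell, row `S` of the binder ledger, (S-restr)/(x-S)): the S-side line
representations `((S V c).P k).ω`, `k = 2, 3`, of the Hodge-CM period packet live on the second plane `diag(a₂, a₃) ≅ diag(a₀, a₁)`
(`g₀ := isoGL`, torus embedding `t ↦ isoGL · diag(t₀,t₁) · isoGL⁻¹`); binder-1's `SeesawHyp34.seesaw` is
`thetaDistLM_cmPairRepTwist_cmAdelicEquiv_cmConjLineTensorFin`.  Nothing here is a claim of the manuscripts under adjudication; the three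
`CompatibleSplitting` hypotheses are [GelbartRogawski1991, Prop. 3.1.1] verbatim.
-/

set_option autoImplicit false

noncomputable section

open scoped Matrix Kronecker
open NumberField
open Literature.RepresentationTheory Literature.RepresentationTheory.SeesawScalar
open Literature.NumberTheory.Automorphic
open Literature.NumberTheory.Automorphic.UnitaryGroup
open Literature.NumberTheory.Weil1964

namespace Literature.NumberTheory.GelbartRogawski1991

namespace UnitaryDualPair

/-! ## §0. The second plane `diag(b₀,b₁) ≅ diag(a₀,a₁)` through a rational isometry `g₀`: the `(34)` data `g = g₀ ⊗ 1`,
`C = 1 ⊗ diag(bᵢ/aᵢ) ⊗ 1` -/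

section ConjPlane

variable (L : Type) [Field L] [NumberField L] [IsCMField L]

/-- a rational isometry `g₀ : (L², diag b) ≅ (L², diag a)`, `ᵗḡ₀ · diag(a) · g₀ = diag(b)`, is an isometry `diag(a) ≅ ⟨b₀⟩ ⊕ᶠ ⟨b₁⟩`
(hypothesis `hg₀U` of the `(34)` scheme's rational stabiliser lemma). [folklore] -/
theorem ratIsometry_conj (a b : Fin 2 → L) (g₀ : GL (Fin 2) L)
    (hg₀ : ((g₀ : Matrix (Fin 2) (Fin 2) L).map (IsCMField.complexConj L : L →+* L))ᵀ * Matrix.diagonal a *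
      (g₀ : Matrix (Fin 2) (Fin 2) L) = Matrix.diagonal b) :
    (((g₀ : GL (Fin (1 + 1)) L) : Matrix (Fin (1 + 1)) (Fin (1 + 1)) L).map (IsCMField.complexConj L : L →+* L))ᵀ *
        Matrix.diagonal a * ((g₀ : GL (Fin (1 + 1)) L) : Matrix (Fin (1 + 1)) (Fin (1 + 1)) L) =
      finSum 1 1 (Matrix.diagonal (lineVec L (b 0))) (Matrix.diagonal (lineVec L (b 1))) := by
  rw [finSum_diagonal_lineVec]
  exact hg₀

/-- **`g = g₀ ⊗ 1` is an adelic isometry `(W ⊗ 𝔸, ⟨b₀⟩ ⊕ᶠ ⟨b₁⟩) ≅ (W ⊗ 𝔸, diag(a₀, a₁))`** (hypothesis `hg` of the `(34)` scheme;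
`isometry_map` along the diagonal embedding `L → 𝔸_L`, which intertwines `c` and `c ⊗ 1`). [folklore] -/
theorem adelicIsometry_conj (a b : Fin 2 → L) (g₀ : GL (Fin 2) L)
    (hg₀ : ((g₀ : Matrix (Fin 2) (Fin 2) L).map (IsCMField.complexConj L : L →+* L))ᵀ * Matrix.diagonal a *
      (g₀ : Matrix (Fin 2) (Fin 2) L) = Matrix.diagonal b) :
    (((toAdeleGL L g₀ : GL (Fin (1 + 1)) (AdeleRing (𝓞 L) L)) : Matrix (Fin (1 + 1)) (Fin (1 + 1)) (AdeleRing (𝓞 L) L)).map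
          (conjAdele (↥(maximalRealSubfield L)) L (IsCMField.complexConj L)))ᵀ *
        adelicForm L (1 + 1) (Matrix.diagonal a) *
        ((toAdeleGL L g₀ : GL (Fin (1 + 1)) (AdeleRing (𝓞 L) L)) : Matrix (Fin (1 + 1)) (Fin (1 + 1)) (AdeleRing (𝓞 L) L)) =
      adelicForm L (1 + 1) (finSum 1 1 (Matrix.diagonal (lineVec L (b 0))) (Matrix.diagonal (lineVec L (b 1)))) :=
  isometry_map (algebraMap L (AdeleRing (𝓞 L) L)) (algebraMap_conj (↥(maximalRealSubfield L)) L (IsCMField.complexConj L))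
    (ratIsometry_conj L a b g₀ hg₀)

/-- `(A ⊗ₖ B).map f = A.map f ⊗ₖ B.map f` for a ring homomorphism `f : R →+* S` (the tree's `kronecker_map` is the case `R = S`).
[folklore] -/
theorem kronecker_map' {R S : Type*} [CommSemiring R] [CommSemiring S] {l m p q : Type*} (f : R →+* S) (A : Matrix l m R)
    (B : Matrix p q R) : (A ⊗ₖ B).map f = A.map f ⊗ₖ B.map f := by
  ext ⟨i, i'⟩ ⟨j, j'⟩
  simp only [Matrix.map_apply, Matrix.kroneckerMap_apply, map_mul]

/-- the ratios `bᵢ / aᵢ ∈ L⁺` of two (conjugation-fixed) diagonal Gram vectors. [folklore] -/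
def conjScale (a : Fin 2 → L) (ha : ∀ i, IsCMField.complexConj L (a i) = a i) (b : Fin 2 → L)
    (hb : ∀ i, IsCMField.complexConj L (b i) = b i) (i : Fin 2) : ↥(maximalRealSubfield L) :=
  (⟨b i, (IsCMField.complexConj_eq_self_iff (K := L) (b i)).1 (hb i)⟩ : ↥(maximalRealSubfield L)) /
    ⟨a i, (IsCMField.complexConj_eq_self_iff (K := L) (a i)).1 (ha i)⟩

/-- `diag(a) · diag(b/a) = diag(b)` over `L⁺`. [folklore] -/
theorem realDiagonal_mul_diagonal_conjScale (a : Fin 2 → L) (ha : ∀ i, IsCMField.complexConj L (a i) = a i) (ha0 : ∀ i, a i ≠ 0)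
    (b : Fin 2 → L) (hb : ∀ i, IsCMField.complexConj L (b i) = b i) :
    realDiagonal L a ha * Matrix.diagonal (conjScale L a ha b hb) = realDiagonal L b hb := by
  rw [realDiagonal, realDiagonal, Matrix.diagonal_mul_diagonal]
  refine congrArg Matrix.diagonal (funext fun i => ?_)
  rw [conjScale, mul_div_assoc', mul_div_cancel_left₀]
  exact fun h => ha0 i (congrArg Subtype.val h)

/-- `1 ⊗ diag(b/a) ∈ M_{N × 2}(L⁺)` is invertible. [folklore] -/
theorem isUnit_one_kronecker_diagonal_conjScale {N : ℕ} (a : Fin 2 → L) (ha : ∀ i, IsCMField.complexConj L (a i) = a i)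
    (ha0 : ∀ i, a i ≠ 0) (b : Fin 2 → L) (hb : ∀ i, IsCMField.complexConj L (b i) = b i) (hb0 : ∀ i, b i ≠ 0) :
    IsUnit ((1 : Matrix (Fin N) (Fin N) ↥(maximalRealSubfield L)) ⊗ₖ
      (Matrix.diagonal (conjScale L a ha b hb) : Matrix (Fin (1 + 1)) (Fin (1 + 1)) ↥(maximalRealSubfield L))) :=
  (Matrix.isUnit_iff_isUnit_det _).2 (by
    rw [Matrix.det_kronecker, Matrix.det_one, one_pow, one_mul, Matrix.det_diagonal]
    exact IsUnit.pow _ (isUnit_iff_ne_zero.2 (Finset.prod_ne_zero_iff.2 fun i _ =>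
      div_ne_zero (fun h => hb0 i (congrArg Subtype.val h)) fun h => ha0 i (congrArg Subtype.val h))))

/-- **the rational Gram intertwiner `C₀ = 1 ⊗ diag(bᵢ/aᵢ) ∈ GL_{N × 2}(L⁺)`**. [folklore] -/
def gramConj₀ {N : ℕ} (a : Fin 2 → L) (ha : ∀ i, IsCMField.complexConj L (a i) = a i) (ha0 : ∀ i, a i ≠ 0) (b : Fin 2 → L)
    (hb : ∀ i, IsCMField.complexConj L (b i) = b i) (hb0 : ∀ i, b i ≠ 0) : GL (Fin N × Fin (1 + 1)) ↥(maximalRealSubfield L) :=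
  (isUnit_one_kronecker_diagonal_conjScale L (N := N) a ha ha0 b hb hb0).unit

/-- its matrix. [folklore] -/
theorem coe_gramConj₀ {N : ℕ} (a : Fin 2 → L) (ha : ∀ i, IsCMField.complexConj L (a i) = a i) (ha0 : ∀ i, a i ≠ 0) (b : Fin 2 → L)
    (hb : ∀ i, IsCMField.complexConj L (b i) = b i) (hb0 : ∀ i, b i ≠ 0) :
    ((gramConj₀ L (N := N) a ha ha0 b hb hb0 : GL (Fin N × Fin (1 + 1)) ↥(maximalRealSubfield L)) :
        Matrix (Fin N × Fin (1 + 1)) (Fin N × Fin (1 + 1)) ↥(maximalRealSubfield L)) =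
      (1 : Matrix (Fin N) (Fin N) ↥(maximalRealSubfield L)) ⊗ₖ
        (Matrix.diagonal (conjScale L a ha b hb) : Matrix (Fin (1 + 1)) (Fin (1 + 1)) ↥(maximalRealSubfield L)) :=
  rfl

/-- **the adelic Gram intertwiner `C = C₀ ⊗ 1 ∈ GL_{N × 2}(𝔸_{L⁺})`**. [folklore] -/
def gramConj {N : ℕ} (a : Fin 2 → L) (ha : ∀ i, IsCMField.complexConj L (a i) = a i) (ha0 : ∀ i, a i ≠ 0) (b : Fin 2 → L)
    (hb : ∀ i, IsCMField.complexConj L (b i) = b i) (hb0 : ∀ i, b i ≠ 0) :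
    GL (Fin N × Fin (1 + 1)) (AdeleRing (𝓞 ↥(maximalRealSubfield L)) ↥(maximalRealSubfield L)) :=
  Matrix.GeneralLinearGroup.map
    (algebraMap (↥(maximalRealSubfield L)) (AdeleRing (𝓞 ↥(maximalRealSubfield L)) ↥(maximalRealSubfield L)))
    (gramConj₀ L (N := N) a ha ha0 b hb hb0)

/-- `C` is the rational point `C₀` (hypothesis `hCC₀` of the `(34)` scheme). [folklore] -/
theorem coe_gramConj {N : ℕ} (a : Fin 2 → L) (ha : ∀ i, IsCMField.complexConj L (a i) = a i) (ha0 : ∀ i, a i ≠ 0) (b : Fin 2 → L)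
    (hb : ∀ i, IsCMField.complexConj L (b i) = b i) (hb0 : ∀ i, b i ≠ 0) :
    ((gramConj L (N := N) a ha ha0 b hb hb0 :
          GL (Fin N × Fin (1 + 1)) (AdeleRing (𝓞 ↥(maximalRealSubfield L)) ↥(maximalRealSubfield L))) :
        Matrix (Fin N × Fin (1 + 1)) (Fin N × Fin (1 + 1)) (AdeleRing (𝓞 ↥(maximalRealSubfield L)) ↥(maximalRealSubfield L))) =
      ((gramConj₀ L (N := N) a ha ha0 b hb hb0 : GL (Fin N × Fin (1 + 1)) ↥(maximalRealSubfield L)) :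
          Matrix (Fin N × Fin (1 + 1)) (Fin N × Fin (1 + 1)) ↥(maximalRealSubfield L)).map
        (algebraMap (↥(maximalRealSubfield L)) (AdeleRing (𝓞 ↥(maximalRealSubfield L)) ↥(maximalRealSubfield L))) :=
  rfl

/-- **`C` intertwines the Gram matrices `T_V ⊗ diag(a) ⊗ 1` and `T_V ⊗ (⟨b₀⟩ ⊕ᶠ ⟨b₁⟩) ⊗ 1`** (hypothesis `hC` of the `(34)` scheme):
`(T_V ⊗ diag a)(1 ⊗ diag(b/a)) = T_V ⊗ diag b`. [folklore] -/
theorem gramIntertwiner_conj {N : ℕ} (a : Fin 2 → L) (ha : ∀ i, IsCMField.complexConj L (a i) = a i) (ha0 : ∀ i, a i ≠ 0)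
    (b : Fin 2 → L) (hb : ∀ i, IsCMField.complexConj L (b i) = b i) (hb0 : ∀ i, b i ≠ 0)
    (TV : Matrix (Fin N) (Fin N) ↥(maximalRealSubfield L)) :
    TV.map (algebraMap (↥(maximalRealSubfield L)) (AdeleRing (𝓞 ↥(maximalRealSubfield L)) ↥(maximalRealSubfield L))) ⊗ₖ
          (realDiagonal L a ha).map
            (algebraMap (↥(maximalRealSubfield L)) (AdeleRing (𝓞 ↥(maximalRealSubfield L)) ↥(maximalRealSubfield L))) *
        ((gramConj L (N := N) a ha ha0 b hb hb0 :
            GL (Fin N × Fin (1 + 1)) (AdeleRing (𝓞 ↥(maximalRealSubfield L)) ↥(maximalRealSubfield L))) :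
          Matrix (Fin N × Fin (1 + 1)) (Fin N × Fin (1 + 1))
            (AdeleRing (𝓞 ↥(maximalRealSubfield L)) ↥(maximalRealSubfield L))) =
      TV.map (algebraMap (↥(maximalRealSubfield L)) (AdeleRing (𝓞 ↥(maximalRealSubfield L)) ↥(maximalRealSubfield L))) ⊗ₖ
        (finSum 1 1 (realDiagonal L (lineVec L (b 0)) fun _ => hb 0)
            (realDiagonal L (lineVec L (b 1)) fun _ => hb 1)).map
          (algebraMap (↥(maximalRealSubfield L)) (AdeleRing (𝓞 ↥(maximalRealSubfield L)) ↥(maximalRealSubfield L))) := by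
  rw [finSum_realDiagonal_lineVec, coe_gramConj, coe_gramConj₀, kronecker_map', Matrix.map_one _ (map_zero _) (map_one _),
    ← Matrix.mul_kronecker_mul, Matrix.mul_one, ← Matrix.map_mul, realDiagonal_mul_diagonal_conjScale L a ha ha0 b hb]

end ConjPlane

/-! ## §1. K-1's `(34)`-currency line representations and see-saw tensor at the CM data, `g = g₀ ⊗ 1`, `C = 1 ⊗ diag(bᵢ/aᵢ) ⊗ 1` -/

section Raw

variable (L : Type) [Field L] [NumberField L] [IsCMField L] {N n n₁ : ℕ}
  (e : Fin N × Fin 2 ≃ Fin n) (e₁ : Fin N × Fin 1 ≃ Fin n₁)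
variable (dV : Fin N → L) (hdV : ∀ i, IsCMField.complexConj L (dV i) = dV i) (hdV0 : ∀ i, dV i ≠ 0)
variable (a : Fin 2 → L) (ha : ∀ i, IsCMField.complexConj L (a i) = a i) (ha0 : ∀ i, a i ≠ 0)
variable (b : Fin 2 → L) (hb : ∀ i, IsCMField.complexConj L (b i) = b i) (hb0 : ∀ i, b i ≠ 0) (g₀ : GL (Fin 2) L)
  (hg₀ : ((g₀ : Matrix (Fin 2) (Fin 2) L).map (IsCMField.complexConj L : L →+* L))ᵀ * Matrix.diagonal a *
    (g₀ : Matrix (Fin 2) (Fin 2) L) = Matrix.diagonal b)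
variable (hGR : (cmSplittingDatum L e dV hdV hdV0 a ha ha0).CompatibleSplitting)
  (hGR₀ : (cmSplittingDatum L e₁ dV hdV hdV0 (lineVec L (b 0)) (fun _ => hb 0) (fun _ => hb0 0)).CompatibleSplitting)
  (hGR₁ : (cmSplittingDatum L e₁ dV hdV hdV0 (lineVec L (b 1)) (fun _ => hb 1) (fun _ => hb0 1)).CompatibleSplitting)

/-- **`ω₀″`**: K-1's renormalised `(34)`-currency line representation `seesawConjRep₁` of `U(diag dV)(𝔸) × U(⟨b₀⟩)(𝔸)` on
`𝒮(𝔸_{L⁺}^{N × 1})`, at the CM data, `g = g₀ ⊗ 1`, `C = 1 ⊗ diag(bᵢ/aᵢ) ⊗ 1`, splittings `splittingOf hGR, splittingOf hGR₀, splittingOf hGR₁`.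
[cite: Howe1979, §3] -/
def cmConjLineRepRaw₀ :
    Representation ℂ (CMAdelic L dV × CMAdelic L (lineVec L (b 0)))
      (piSchwartzBruhat (↥(maximalRealSubfield L)) (Fin N × Fin 1)) :=
  seesawConjRep₁ (↥(maximalRealSubfield L)) L (IsCMField.complexConj L) N 1 1 e e₁ e₁ (Matrix.diagonal dV)
    (Matrix.diagonal a) (Matrix.diagonal (lineVec L (b 0))) (Matrix.diagonal (lineVec L (b 1)))
    (complexConj_imagUnit L) (imagUnit_ne_zero L) (imagUnit_mul_self L)
    (realDiagonal_isSymm L dV hdV) (realDiagonal_isSymm L a ha)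
    (realDiagonal_isSymm L (lineVec L (b 0)) fun _ => hb 0) (realDiagonal_isSymm L (lineVec L (b 1)) fun _ => hb 1)
    (isUnit_det_realDiagonal L dV hdV hdV0) (isUnit_det_realDiagonal L a ha ha0)
    (isUnit_det_realDiagonal L (lineVec L (b 0)) (fun _ => hb 0) fun _ => hb0 0)
    (isUnit_det_realDiagonal L (lineVec L (b 1)) (fun _ => hb 1) fun _ => hb0 1)
    ((Matrix.isUnit_iff_isUnit_det _).1
      (isUnit_kronecker_map (↥(maximalRealSubfield L)) N (isUnit_det_realDiagonal L dV hdV hdV0)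
        (isUnit_det_realDiagonal L a ha ha0)))
    (realDiagonal_map L dV hdV).symm (realDiagonal_map L a ha).symm
    (realDiagonal_map L (lineVec L (b 0)) fun _ => hb 0).symm (realDiagonal_map L (lineVec L (b 1)) fun _ => hb 1).symm
    (val_toAdeleGL L g₀) (adelicIsometry_conj L a b g₀ hg₀)
    (coe_gramConj L a ha ha0 b hb hb0)
    (gramIntertwiner_conj L a ha ha0 b hb hb0 (realDiagonal L dV hdV))
    (splittingOf_isCompatible _ _ _ _ _ _ _ _ _ _ _ _ _ _ _ _ _ hGR)
    (splittingOf_isCompatible _ _ _ _ _ _ _ _ _ _ _ _ _ _ _ _ _ hGR₀)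
    (splittingOf_isCompatible _ _ _ _ _ _ _ _ _ _ _ _ _ _ _ _ _ hGR₁)

/-- **`ω₁″`**: K-1's renormalised `(34)`-currency line representation `seesawConjRep₂` of `U(diag dV)(𝔸) × U(⟨b₁⟩)(𝔸)` on
`𝒮(𝔸_{L⁺}^{N × 1})`, at the CM data, `g = g₀ ⊗ 1`, `C = 1 ⊗ diag(bᵢ/aᵢ) ⊗ 1`. [cite: Howe1979, §3] -/
def cmConjLineRepRaw₁ :
    Representation ℂ (CMAdelic L dV × CMAdelic L (lineVec L (b 1)))
      (piSchwartzBruhat (↥(maximalRealSubfield L)) (Fin N × Fin 1)) :=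
  seesawConjRep₂ (↥(maximalRealSubfield L)) L (IsCMField.complexConj L) N 1 1 e e₁ e₁ (Matrix.diagonal dV)
    (Matrix.diagonal a) (Matrix.diagonal (lineVec L (b 0))) (Matrix.diagonal (lineVec L (b 1)))
    (complexConj_imagUnit L) (imagUnit_ne_zero L) (imagUnit_mul_self L)
    (realDiagonal_isSymm L dV hdV) (realDiagonal_isSymm L a ha)
    (realDiagonal_isSymm L (lineVec L (b 0)) fun _ => hb 0) (realDiagonal_isSymm L (lineVec L (b 1)) fun _ => hb 1)
    (isUnit_det_realDiagonal L dV hdV hdV0) (isUnit_det_realDiagonal L a ha ha0)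
    (isUnit_det_realDiagonal L (lineVec L (b 0)) (fun _ => hb 0) fun _ => hb0 0)
    (isUnit_det_realDiagonal L (lineVec L (b 1)) (fun _ => hb 1) fun _ => hb0 1)
    ((Matrix.isUnit_iff_isUnit_det _).1
      (isUnit_kronecker_map (↥(maximalRealSubfield L)) N (isUnit_det_realDiagonal L dV hdV hdV0)
        (isUnit_det_realDiagonal L a ha ha0)))
    (realDiagonal_map L dV hdV).symm (realDiagonal_map L a ha).symm
    (realDiagonal_map L (lineVec L (b 0)) fun _ => hb 0).symm (realDiagonal_map L (lineVec L (b 1)) fun _ => hb 1).symm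
    (val_toAdeleGL L g₀) (adelicIsometry_conj L a b g₀ hg₀)
    (coe_gramConj L a ha ha0 b hb hb0)
    (gramIntertwiner_conj L a ha ha0 b hb hb0 (realDiagonal L dV hdV))
    (splittingOf_isCompatible _ _ _ _ _ _ _ _ _ _ _ _ _ _ _ _ _ hGR)
    (splittingOf_isCompatible _ _ _ _ _ _ _ _ _ _ _ _ _ _ _ _ _ hGR₀)
    (splittingOf_isCompatible _ _ _ _ _ _ _ _ _ _ _ _ _ _ _ _ _ hGR₁)

/-- **`⊗″ = cmConjLineTensor`**: the pure tensor of two small test functions read in the big pair `(U(diag dV), U(diag a))`'s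
Schrödinger model of record `𝒮(𝔸^n)` through the see-saw element (`seesawConjTensor` at the CM data, `g = g₀ ⊗ 1`, `C = 1 ⊗ diag(bᵢ/aᵢ) ⊗ 1`;
bilinear). [folklore] -/
def cmConjLineTensor :
    piSchwartzBruhat (↥(maximalRealSubfield L)) (Fin N × Fin 1) →ₗ[ℂ]
      piSchwartzBruhat (↥(maximalRealSubfield L)) (Fin N × Fin 1) →ₗ[ℂ]
        piSchwartzBruhat (↥(maximalRealSubfield L)) (Fin n) :=
  seesawConjTensor (↥(maximalRealSubfield L)) L (IsCMField.complexConj L) N 1 1 e (Matrix.diagonal dV)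
    (Matrix.diagonal a) (Matrix.diagonal (lineVec L (b 0))) (Matrix.diagonal (lineVec L (b 1)))
    (complexConj_imagUnit L) (imagUnit_ne_zero L) (imagUnit_mul_self L)
    (realDiagonal_isSymm L dV hdV) (realDiagonal_isSymm L a ha)
    (realDiagonal_isSymm L (lineVec L (b 0)) fun _ => hb 0) (realDiagonal_isSymm L (lineVec L (b 1)) fun _ => hb 1)
    (isUnit_det_realDiagonal L dV hdV hdV0) (isUnit_det_realDiagonal L a ha ha0)
    ((Matrix.isUnit_iff_isUnit_det _).1
      (isUnit_kronecker_map (↥(maximalRealSubfield L)) N (isUnit_det_realDiagonal L dV hdV hdV0)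
        (isUnit_det_realDiagonal L a ha ha0)))
    (realDiagonal_map L dV hdV).symm (realDiagonal_map L a ha).symm
    (realDiagonal_map L (lineVec L (b 0)) fun _ => hb 0).symm (realDiagonal_map L (lineVec L (b 1)) fun _ => hb 1).symm
    (val_toAdeleGL L g₀) (adelicIsometry_conj L a b g₀ hg₀)
    (coe_gramConj L a ha ha0 b hb hb0)
    (gramIntertwiner_conj L a ha ha0 b hb hb0 (realDiagonal L dV hdV))

/-- **the CONJUGATED torus element `(g₀ ⊗ 1) · (u₀ ⊕ᶠ u₁) · (g₀ ⊗ 1)⁻¹ ∈ U(diag(a₀,a₁))(𝔸)`** of a pair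
`(u₀, u₁) ∈ U(⟨b₀⟩)(𝔸) × U(⟨b₁⟩)(𝔸)` (`adelicBlockDiag` conjugated by the adelic isometry `g = g₀ ⊗ 1`). [cite: Kudla1984, §1] -/
def cmConjPlaneBlockDiag : CMAdelic L (lineVec L (b 0)) × CMAdelic L (lineVec L (b 1)) →* CMAdelic L a :=
  (adelicIsometryConj (↥(maximalRealSubfield L)) L (IsCMField.complexConj L) (1 + 1) (toAdeleGL L g₀)
      (adelicIsometry_conj L a b g₀ hg₀)).comp
    (adelicBlockDiag (↥(maximalRealSubfield L)) L (IsCMField.complexConj L) 1 1 (Matrix.diagonal (lineVec L (b 0)))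
      (Matrix.diagonal (lineVec L (b 1))))

set_option maxHeartbeats 800000 in
/-- **THE SEE-SAW RESTRICTION AT OPERATOR LEVEL for the CM pair representation `ω_ψ ∘ s_pair`** along the plane's torus:
`ω_ψ(s_pair(v, g(u₀ ⊕ᶠ u₁)g⁻¹)) (Φ₁ ⊗″ Φ₂) = (ω₀″(v,u₀) Φ₁) ⊗″ (ω₁″(v,u₁) Φ₂)` (`pairRep_isometryConj_seesawConjTensor` at the CM data).
[cite: Howe1979, §3] -/
theorem cmPairRep_conjBlockDiag_cmConjLineTensor (v : CMAdelic L dV) (u₀ : CMAdelic L (lineVec L (b 0)))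
    (u₁ : CMAdelic L (lineVec L (b 1))) (Φ₁ Φ₂ : piSchwartzBruhat (↥(maximalRealSubfield L)) (Fin N × Fin 1)) :
    cmPairRep L e dV hdV hdV0 a ha ha0 hGR (v, cmConjPlaneBlockDiag L a b g₀ hg₀ (u₀, u₁))
        (cmConjLineTensor L e dV hdV hdV0 a ha ha0 b hb hb0 g₀ hg₀ Φ₁ Φ₂) =
      cmConjLineTensor L e dV hdV hdV0 a ha ha0 b hb hb0 g₀ hg₀ (cmConjLineRepRaw₀ L e e₁ dV hdV hdV0 a ha ha0 b hb hb0 g₀ hg₀ hGR hGR₀ hGR₁ (v, u₀) Φ₁)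
        (cmConjLineRepRaw₁ L e e₁ dV hdV hdV0 a ha ha0 b hb hb0 g₀ hg₀ hGR hGR₀ hGR₁ (v, u₁) Φ₂) :=
  pairRep_isometryConj_seesawConjTensor (↥(maximalRealSubfield L)) L (IsCMField.complexConj L) N 1 1 e e₁ e₁
    (Matrix.diagonal dV) (Matrix.diagonal a) (Matrix.diagonal (lineVec L (b 0))) (Matrix.diagonal (lineVec L (b 1)))
    (complexConj_imagUnit L) (imagUnit_ne_zero L) (imagUnit_mul_self L)
    (realDiagonal_isSymm L dV hdV) (realDiagonal_isSymm L a ha)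
    (realDiagonal_isSymm L (lineVec L (b 0)) fun _ => hb 0) (realDiagonal_isSymm L (lineVec L (b 1)) fun _ => hb 1)
    (isUnit_det_realDiagonal L dV hdV hdV0) (isUnit_det_realDiagonal L a ha ha0)
    (isUnit_det_realDiagonal L (lineVec L (b 0)) (fun _ => hb 0) fun _ => hb0 0)
    (isUnit_det_realDiagonal L (lineVec L (b 1)) (fun _ => hb 1) fun _ => hb0 1)
    ((Matrix.isUnit_iff_isUnit_det _).1
      (isUnit_kronecker_map (↥(maximalRealSubfield L)) N (isUnit_det_realDiagonal L dV hdV hdV0)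
        (isUnit_det_realDiagonal L a ha ha0)))
    (realDiagonal_map L dV hdV).symm (realDiagonal_map L a ha).symm
    (realDiagonal_map L (lineVec L (b 0)) fun _ => hb 0).symm (realDiagonal_map L (lineVec L (b 1)) fun _ => hb 1).symm
    (val_toAdeleGL L g₀) (adelicIsometry_conj L a b g₀ hg₀)
    (coe_gramConj L a ha ha0 b hb hb0)
    (gramIntertwiner_conj L a ha ha0 b hb hb0 (realDiagonal L dV hdV))
    (splittingOf_isCompatible _ _ _ _ _ _ _ _ _ _ _ _ _ _ _ _ _ hGR)
    (splittingOf_isCompatible _ _ _ _ _ _ _ _ _ _ _ _ _ _ _ _ _ hGR₀)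
    (splittingOf_isCompatible _ _ _ _ _ _ _ _ _ _ _ _ _ _ _ _ _ hGR₁) v u₀ u₁ Φ₁ Φ₂

/-- **the theta functional is multiplicative on `⊗″`**: `Θ(Φ₁ ⊗″ Φ₂) = Θ(Φ₁) · Θ(Φ₂)` — `Θ` is invariant under the
re-indexings `R_{e_W}`, `R_f` and under `ω(r_F h₀)` for the RATIONAL see-saw element `h₀` (Weil's Théorème 6), and multiplicative
on `Φ₁ ⊠ Φ₂` (`thetaDistLM_tensorToSum`). [cite: Weil1964, Chap. III n° 41 Thm 6 p. 193] -/
theorem thetaDistLM_cmConjLineTensor (Φ₁ Φ₂ : piSchwartzBruhat (↥(maximalRealSubfield L)) (Fin N × Fin 1)) :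
    thetaDistLM (↥(maximalRealSubfield L)) (Fin n) (cmConjLineTensor L e dV hdV hdV0 a ha ha0 b hb hb0 g₀ hg₀ Φ₁ Φ₂) =
      thetaDistLM (↥(maximalRealSubfield L)) (Fin N × Fin 1) Φ₁ *
        thetaDistLM (↥(maximalRealSubfield L)) (Fin N × Fin 1) Φ₂ := by
  rw [cmConjLineTensor, seesawConjTensor_apply, thetaDistLM_piSBReindex, thetaDistLM_apply,
    thetaDist_omega_ratPointsThetaLiftCont, ← thetaDistLM_apply, piSBReindex_symm, thetaDistLM_piSBReindex,
    thetaDistLM_tensorToSum]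

end Raw

/-! ## §2. The diagonal torus `U(1) × U(1) ↪ U(diag(a₀,a₁))`, `(u₀,u₁) ↦ (g₀ ⊗ 1)·diag(u₀,u₁)·(g₀ ⊗ 1)⁻¹`, and the split of the normalising character `η` -/

section Torus

variable (L : Type) [Field L] [NumberField L] [IsCMField L] {N : ℕ} (dV : Fin N → L)
variable (a b : Fin 2 → L) (g₀ : GL (Fin 2) L)
  (hg₀ : ((g₀ : Matrix (Fin 2) (Fin 2) L).map (IsCMField.complexConj L : L →+* L))ᵀ * Matrix.diagonal a *
    (g₀ : Matrix (Fin 2) (Fin 2) L) = Matrix.diagonal b)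

/-- **the CONJUGATED torus** `(u₀, u₁) ↦ (g₀ ⊗ 1) · diag(u₀, u₁) · (g₀ ⊗ 1)⁻¹ : U(1)(𝔸) × U(1)(𝔸) →* U(diag(a₀,a₁))(𝔸)` (through the
centres of the two lines `⟨b₀⟩, ⟨b₁⟩`, `cmConjPlaneBlockDiag ∘ (adelicCenter × adelicCenter)`). [cite: Kudla1984, §1] -/
def cmConjPlaneTorus : CMAdelicOne L × CMAdelicOne L →* CMAdelic L a :=
  (cmConjPlaneBlockDiag L a b g₀ hg₀).comp ((CMCenter L (lineVec L (b 0))).prodMap (CMCenter L (lineVec L (b 1))))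

/-- unfolding. [folklore] -/
theorem cmConjPlaneTorus_apply (u₀ u₁ : CMAdelicOne L) :
    cmConjPlaneTorus L a b g₀ hg₀ (u₀, u₁) = cmConjPlaneBlockDiag L a b g₀ hg₀ (CMCenter L (lineVec L (b 0)) u₀, CMCenter L (lineVec L (b 1)) u₁) :=
  rfl

/-- in `GL₂(𝔸_L)` the conjugated torus element is `(g₀ ⊗ 1) · diag(u₀, u₁) · (g₀ ⊗ 1)⁻¹`, where `diag(u₀, u₁) = cmPlaneTorus b (u₀, u₁)`
is the DIAGONAL torus element of the plane `diag(b₀, b₁)` (`UnitaryDualPairSeesawCMLines` §2). [cite: Kudla1984, §1] -/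
theorem coe_cmConjPlaneTorus (u₀ u₁ : CMAdelicOne L) :
    ((cmConjPlaneTorus L a b g₀ hg₀ (u₀, u₁) : CMAdelic L a) : GL (Fin 2) (AdeleRing (𝓞 L) L)) =
      toAdeleGL L g₀ * ((cmPlaneTorus L b (u₀, u₁) : CMAdelic L b) : GL (Fin 2) (AdeleRing (𝓞 L) L)) * (toAdeleGL L g₀)⁻¹ := by
  rw [coe_cmPlaneTorus]
  rfl

/-- the first factor `u ↦ (g₀ ⊗ 1) · diag(u, 1) · (g₀ ⊗ 1)⁻¹` of the conjugated torus. [folklore] -/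
def cmConjPlaneTorusInl : CMAdelicOne L →* CMAdelic L a := (cmConjPlaneTorus L a b g₀ hg₀).comp (MonoidHom.inl _ _)

/-- the second factor `u ↦ (g₀ ⊗ 1) · diag(1, u) · (g₀ ⊗ 1)⁻¹` of the conjugated torus. [folklore] -/
def cmConjPlaneTorusInr : CMAdelicOne L →* CMAdelic L a := (cmConjPlaneTorus L a b g₀ hg₀).comp (MonoidHom.inr _ _)

/-- the conjugated torus element of `(u₀, u₁)` is the product of those of `(u₀, 1)` and `(1, u₁)`. [folklore] -/
theorem cmConjPlaneTorus_eq_inl_mul_inr (u₀ u₁ : CMAdelicOne L) :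
    cmConjPlaneTorus L a b g₀ hg₀ (u₀, u₁) = cmConjPlaneTorusInl L a b g₀ hg₀ u₀ * cmConjPlaneTorusInr L a b g₀ hg₀ u₁ := by
  rw [cmConjPlaneTorusInl, cmConjPlaneTorusInr, MonoidHom.comp_apply, MonoidHom.comp_apply, ← map_mul, MonoidHom.inl_apply,
    MonoidHom.inr_apply, Prod.mk_mul_mk, mul_one, one_mul]

variable (η : CMAdelic L dV × CMAdelic L a →* ℂˣ)

/-- **`η₀(v, u) := η(v, g·diag(u, 1)·g⁻¹)`**, the part of the normalising character carried by the first line. [folklore] -/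
def cmConjEta₀ : CMAdelic L dV × CMAdelicOne L →* ℂˣ := η.comp ((MonoidHom.id _).prodMap (cmConjPlaneTorusInl L a b g₀ hg₀))

/-- **`η₁(u) := η(1, g·diag(1, u)·g⁻¹)`**, the part of the normalising character carried by the second line. [folklore] -/
def cmConjEta₁ : CMAdelicOne L →* ℂˣ := η.comp ((MonoidHom.inr _ _).comp (cmConjPlaneTorusInr L a b g₀ hg₀))

/-- **the split of `η` along the torus**: `η(v, g·diag(u₀, u₁)·g⁻¹) = η₀(v, u₀) · η₁(u₁)`. [folklore] -/
theorem cmConjEta_torus (v : CMAdelic L dV) (u₀ u₁ : CMAdelicOne L) :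
    η (v, cmConjPlaneTorus L a b g₀ hg₀ (u₀, u₁)) = cmConjEta₀ L dV a b g₀ hg₀ η (v, u₀) * cmConjEta₁ L dV a b g₀ hg₀ η u₁ := by
  change η (v, cmConjPlaneTorus L a b g₀ hg₀ (u₀, u₁)) = η (v, cmConjPlaneTorusInl L a b g₀ hg₀ u₀) * η (1, cmConjPlaneTorusInr L a b g₀ hg₀ u₁)
  rw [← map_mul, Prod.mk_mul_mk, mul_one, cmConjPlaneTorus_eq_inl_mul_inr]

end Torus

/-! ## §3. The twisted line representations and the see-saw restriction of the NORMALISED pair representation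

The normalising character `η` of `U(V)(𝔸) × U(W)(𝔸)` restricted to `U(V) × (U(1) × U(1))` is distributed over the two
lines by ANY pair of characters `η₀, η₁` of `U(V)(𝔸) × U(1)(𝔸)` with `η(v, g·diag(u₀,u₁)·g⁻¹) = η₀(v,u₀) · η₁(v,u₁)` (hypothesis
`hη` below; the restriction identity is bilinear in the two scalars, so every split is admissible). The DEFAULT split
`η₀ := cmConjEta₀ η`, `η₁ := cmConjEta₁ η ∘ snd` (`cmConjEta_torus`) is one instance (`cmPairRepTwist_conjTorus_cmConjLineTensor_default`). -/

section Lines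

variable (L : Type) [Field L] [NumberField L] [IsCMField L] {N n n₁ : ℕ}
  (e : Fin N × Fin 2 ≃ Fin n) (e₁ : Fin N × Fin 1 ≃ Fin n₁)
variable (dV : Fin N → L) (hdV : ∀ i, IsCMField.complexConj L (dV i) = dV i) (hdV0 : ∀ i, dV i ≠ 0)
variable (a : Fin 2 → L) (ha : ∀ i, IsCMField.complexConj L (a i) = a i) (ha0 : ∀ i, a i ≠ 0)
variable (b : Fin 2 → L) (hb : ∀ i, IsCMField.complexConj L (b i) = b i) (hb0 : ∀ i, b i ≠ 0) (g₀ : GL (Fin 2) L)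
  (hg₀ : ((g₀ : Matrix (Fin 2) (Fin 2) L).map (IsCMField.complexConj L : L →+* L))ᵀ * Matrix.diagonal a *
    (g₀ : Matrix (Fin 2) (Fin 2) L) = Matrix.diagonal b)
variable (hGR : (cmSplittingDatum L e dV hdV hdV0 a ha ha0).CompatibleSplitting)
  (hGR₀ : (cmSplittingDatum L e₁ dV hdV hdV0 (lineVec L (b 0)) (fun _ => hb 0) (fun _ => hb0 0)).CompatibleSplitting)
  (hGR₁ : (cmSplittingDatum L e₁ dV hdV hdV0 (lineVec L (b 1)) (fun _ => hb 1) (fun _ => hb0 1)).CompatibleSplitting)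
  (η : CMAdelic L dV × CMAdelic L a →* ℂˣ) (η₀ η₁ : CMAdelic L dV × CMAdelicOne L →* ℂˣ)

/-- **`cmConjLineRep₀ = η₀ • ω₀″`**: the line representation of `U(diag dV)(𝔸) × U(1)(𝔸)` on `𝒮(𝔸_{L⁺}^{N × 1})` attached to
the first line `⟨b₀⟩` of the second plane (`g = g₀ ⊗ 1`) — K-1's renormalised `(34)` representation pulled back along the centre `u ↦ u · 1` and twisted by a
character `η₀`. [cite: GelbartRogawski1991, §3.1 Remark p. 457 L4–13] -/
def cmConjLineRep₀ :
    Representation ℂ (CMAdelic L dV × CMAdelicOne L) (piSchwartzBruhat (↥(maximalRealSubfield L)) (Fin N × Fin 1)) :=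
  twist η₀
    ((cmConjLineRepRaw₀ L e e₁ dV hdV hdV0 a ha ha0 b hb hb0 g₀ hg₀ hGR hGR₀ hGR₁).comp
      ((MonoidHom.id _).prodMap (CMCenter L (lineVec L (b 0)))))

/-- **`cmConjLineRep₁ = η₁ • ω₁″`**: the line representation attached to the second line `⟨b₁⟩` of the second plane, twisted by `η₁`.
[cite: GelbartRogawski1991, §3.1 Remark p. 457 L4–13] -/
def cmConjLineRep₁ :
    Representation ℂ (CMAdelic L dV × CMAdelicOne L) (piSchwartzBruhat (↥(maximalRealSubfield L)) (Fin N × Fin 1)) :=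
  twist η₁
    ((cmConjLineRepRaw₁ L e e₁ dV hdV hdV0 a ha ha0 b hb hb0 g₀ hg₀ hGR hGR₀ hGR₁).comp
      ((MonoidHom.id _).prodMap (CMCenter L (lineVec L (b 1)))))

/-- values of `cmConjLineRep₀`. [folklore] -/
theorem cmConjLineRep₀_apply (v : CMAdelic L dV) (u : CMAdelicOne L)
    (Φ : piSchwartzBruhat (↥(maximalRealSubfield L)) (Fin N × Fin 1)) :
    cmConjLineRep₀ L e e₁ dV hdV hdV0 a ha ha0 b hb hb0 g₀ hg₀ hGR hGR₀ hGR₁ η₀ (v, u) Φ =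
      ((η₀ (v, u) : ℂˣ) : ℂ) • cmConjLineRepRaw₀ L e e₁ dV hdV hdV0 a ha ha0 b hb hb0 g₀ hg₀ hGR hGR₀ hGR₁ (v, CMCenter L (lineVec L (b 0)) u) Φ :=
  rfl

/-- values of `cmConjLineRep₁`. [folklore] -/
theorem cmConjLineRep₁_apply (v : CMAdelic L dV) (u : CMAdelicOne L)
    (Φ : piSchwartzBruhat (↥(maximalRealSubfield L)) (Fin N × Fin 1)) :
    cmConjLineRep₁ L e e₁ dV hdV hdV0 a ha ha0 b hb hb0 g₀ hg₀ hGR hGR₀ hGR₁ η₁ (v, u) Φ =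
      ((η₁ (v, u) : ℂˣ) : ℂ) • cmConjLineRepRaw₁ L e e₁ dV hdV hdV0 a ha ha0 b hb hb0 g₀ hg₀ hGR hGR₀ hGR₁ (v, CMCenter L (lineVec L (b 1)) u) Φ :=
  rfl

/-- **THE SEE-SAW RESTRICTION OF THE NORMALISED CM PAIR REPRESENTATION `ω_ψ ∘ (s_pair ⊗ η)` TO THE DIAGONAL TORUS**:
for every split `η(v, g·diag(u₀,u₁)·g⁻¹) = η₀(v,u₀) · η₁(v,u₁)`, all `v ∈ U(diag dV)(𝔸)`, `u₀, u₁ ∈ U(1)(𝔸)` and small test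
functions `Φ₁, Φ₂`,
`(ω_ψ ∘ (s_pair ⊗ η))(v, g·diag(u₀, u₁)·g⁻¹) (Φ₁ ⊗″ Φ₂) = (cmConjLineRep₀ η₀ (v, u₀) Φ₁) ⊗″ (cmConjLineRep₁ η₁ (v, u₁) Φ₂)` — the operator
`op` of the Hodge-CM period packet's `SeesawCore.ofOp`. [cite: Howe1979, §3; GelbartRogawski1991, §3.1 Remark p. 457 L4–13] -/
theorem cmPairRepTwist_conjTorus_cmConjLineTensor
    (hη : ∀ (v : CMAdelic L dV) (u₀ u₁ : CMAdelicOne L), η (v, cmConjPlaneTorus L a b g₀ hg₀ (u₀, u₁)) = η₀ (v, u₀) * η₁ (v, u₁))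
    (v : CMAdelic L dV) (u₀ u₁ : CMAdelicOne L) (Φ₁ Φ₂ : piSchwartzBruhat (↥(maximalRealSubfield L)) (Fin N × Fin 1)) :
    cmPairRepTwist L e dV hdV hdV0 a ha ha0 hGR η (v, cmConjPlaneTorus L a b g₀ hg₀ (u₀, u₁))
        (cmConjLineTensor L e dV hdV hdV0 a ha ha0 b hb hb0 g₀ hg₀ Φ₁ Φ₂) =
      cmConjLineTensor L e dV hdV hdV0 a ha ha0 b hb hb0 g₀ hg₀ (cmConjLineRep₀ L e e₁ dV hdV hdV0 a ha ha0 b hb hb0 g₀ hg₀ hGR hGR₀ hGR₁ η₀ (v, u₀) Φ₁)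
        (cmConjLineRep₁ L e e₁ dV hdV hdV0 a ha ha0 b hb hb0 g₀ hg₀ hGR hGR₀ hGR₁ η₁ (v, u₁) Φ₂) := by
  rw [cmPairRepTwist_apply_eq_smul, cmConjPlaneTorus_apply, cmPairRep_conjBlockDiag_cmConjLineTensor L e e₁ dV hdV hdV0 a ha ha0 b hb hb0 g₀ hg₀
    hGR hGR₀ hGR₁, cmConjLineRep₀_apply, cmConjLineRep₁_apply, LinearMap.map_smul₂, LinearMap.map_smul, smul_smul,
    ← cmConjPlaneTorus_apply, hη, Units.val_mul]

/-- the see-saw restriction at the DEFAULT split `η₀ := cmConjEta₀ η` (all of `η`'s `U(V)`-part on the first line),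
`η₁ := cmConjEta₁ η ∘ snd`. [cite: Howe1979, §3; GelbartRogawski1991, §3.1 Remark p. 457 L4–13] -/
theorem cmPairRepTwist_conjTorus_cmConjLineTensor_default (v : CMAdelic L dV) (u₀ u₁ : CMAdelicOne L)
    (Φ₁ Φ₂ : piSchwartzBruhat (↥(maximalRealSubfield L)) (Fin N × Fin 1)) :
    cmPairRepTwist L e dV hdV hdV0 a ha ha0 hGR η (v, cmConjPlaneTorus L a b g₀ hg₀ (u₀, u₁))
        (cmConjLineTensor L e dV hdV hdV0 a ha ha0 b hb hb0 g₀ hg₀ Φ₁ Φ₂) =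
      cmConjLineTensor L e dV hdV hdV0 a ha ha0 b hb hb0 g₀ hg₀
        (cmConjLineRep₀ L e e₁ dV hdV hdV0 a ha ha0 b hb hb0 g₀ hg₀ hGR hGR₀ hGR₁ (cmConjEta₀ L dV a b g₀ hg₀ η) (v, u₀) Φ₁)
        (cmConjLineRep₁ L e e₁ dV hdV hdV0 a ha ha0 b hb hb0 g₀ hg₀ hGR hGR₀ hGR₁ ((cmConjEta₁ L dV a b g₀ hg₀ η).comp (MonoidHom.snd _ _)) (v, u₁) Φ₂) :=
  cmPairRepTwist_conjTorus_cmConjLineTensor L e e₁ dV hdV hdV0 a ha ha0 b hb hb0 g₀ hg₀ hGR hGR₀ hGR₁ η _ _ (cmConjEta_torus L dV a b g₀ hg₀ η) v u₀ u₁ Φ₁ Φ₂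

end Lines

/-! ## §4. The same in the currencies of the period packet: test functions on `𝒮(𝔸^{n₁})` (re-indexed along
`e₁ : Fin N × Fin 1 ≃ Fin n₁`) and the torus `ker N_{L/L⁺} ≤ 𝔸_L^×` (`relNormOneIdeles`, = `U(1)(𝔸_{L⁺})` by
`cmAdelicOneEquivRelNormOne`) -/

section Fin

variable (L : Type) [Field L] [NumberField L] [IsCMField L] {N n n₁ : ℕ}
  (e : Fin N × Fin 2 ≃ Fin n) (e₁ : Fin N × Fin 1 ≃ Fin n₁)
variable (dV : Fin N → L) (hdV : ∀ i, IsCMField.complexConj L (dV i) = dV i) (hdV0 : ∀ i, dV i ≠ 0)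
variable (a : Fin 2 → L) (ha : ∀ i, IsCMField.complexConj L (a i) = a i) (ha0 : ∀ i, a i ≠ 0)
variable (b : Fin 2 → L) (hb : ∀ i, IsCMField.complexConj L (b i) = b i) (hb0 : ∀ i, b i ≠ 0) (g₀ : GL (Fin 2) L)
  (hg₀ : ((g₀ : Matrix (Fin 2) (Fin 2) L).map (IsCMField.complexConj L : L →+* L))ᵀ * Matrix.diagonal a *
    (g₀ : Matrix (Fin 2) (Fin 2) L) = Matrix.diagonal b)
variable (hGR : (cmSplittingDatum L e dV hdV hdV0 a ha ha0).CompatibleSplitting)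
  (hGR₀ : (cmSplittingDatum L e₁ dV hdV hdV0 (lineVec L (b 0)) (fun _ => hb 0) (fun _ => hb0 0)).CompatibleSplitting)
  (hGR₁ : (cmSplittingDatum L e₁ dV hdV hdV0 (lineVec L (b 1)) (fun _ => hb 1) (fun _ => hb0 1)).CompatibleSplitting)
  (η : CMAdelic L dV × CMAdelic L a →* ℂˣ) (η₀ η₁ : CMAdelic L dV × CMAdelicOne L →* ℂˣ)

/-- **`⊗″` on `𝒮(𝔸^{n₁}) × 𝒮(𝔸^{n₁}) → 𝒮(𝔸^n)`**: `cmConjLineTensor` precomposed with `R_{e₁}⁻¹` in both variables (bilinear).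
[folklore] -/
def cmConjLineTensorFin :
    piSchwartzBruhat (↥(maximalRealSubfield L)) (Fin n₁) →ₗ[ℂ]
      piSchwartzBruhat (↥(maximalRealSubfield L)) (Fin n₁) →ₗ[ℂ] piSchwartzBruhat (↥(maximalRealSubfield L)) (Fin n) :=
  (cmConjLineTensor L e dV hdV hdV0 a ha ha0 b hb hb0 g₀ hg₀).compl₁₂ (piSBReindex (↥(maximalRealSubfield L)) e₁).symm.toLinearMap
    (piSBReindex (↥(maximalRealSubfield L)) e₁).symm.toLinearMap

/-- unfolding. [folklore] -/
theorem cmConjLineTensorFin_apply (φ₁ φ₂ : piSchwartzBruhat (↥(maximalRealSubfield L)) (Fin n₁)) :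
    cmConjLineTensorFin L e e₁ dV hdV hdV0 a ha ha0 b hb hb0 g₀ hg₀ φ₁ φ₂ =
      cmConjLineTensor L e dV hdV hdV0 a ha ha0 b hb hb0 g₀ hg₀ ((piSBReindex (↥(maximalRealSubfield L)) e₁).symm φ₁)
        ((piSBReindex (↥(maximalRealSubfield L)) e₁).symm φ₂) :=
  rfl

/-- **`Θ(φ₁ ⊗″ φ₂) = Θ(φ₁) · Θ(φ₂)`** in the `Fin n₁` currency (the `prod` hypothesis of `SeesawCore.ofOp`).
[cite: Weil1964, Chap. III n° 41 Thm 6 p. 193] -/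
theorem thetaDistLM_cmConjLineTensorFin (φ₁ φ₂ : piSchwartzBruhat (↥(maximalRealSubfield L)) (Fin n₁)) :
    thetaDistLM (↥(maximalRealSubfield L)) (Fin n) (cmConjLineTensorFin L e e₁ dV hdV hdV0 a ha ha0 b hb hb0 g₀ hg₀ φ₁ φ₂) =
      thetaDistLM (↥(maximalRealSubfield L)) (Fin n₁) φ₁ * thetaDistLM (↥(maximalRealSubfield L)) (Fin n₁) φ₂ := by
  rw [cmConjLineTensorFin_apply, thetaDistLM_cmConjLineTensor, piSBReindex_symm, thetaDistLM_piSBReindex,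
    thetaDistLM_piSBReindex]

/-- **`cmConjLineRepFin₀`**: `cmConjLineRep₀ η₀` on `U(diag dV)(𝔸) × ker N_{L/L⁺}` acting on `𝒮(𝔸^{n₁})` (torus through
`cmAdelicOneEquivRelNormOne⁻¹`, model through `R_{e₁}`). [cite: GelbartRogawski1991, §3.1 Remark p. 457 L4–13] -/
def cmConjLineRepFin₀ :
    Representation ℂ (CMAdelic L dV × ↥(relNormOneIdeles (↥(maximalRealSubfield L)) L))
      (piSchwartzBruhat (↥(maximalRealSubfield L)) (Fin n₁)) :=
  (piSBReindex (↥(maximalRealSubfield L)) e₁).conjRingEquiv.toMonoidHom.comp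
    ((cmConjLineRep₀ L e e₁ dV hdV hdV0 a ha ha0 b hb hb0 g₀ hg₀ hGR hGR₀ hGR₁ η₀).comp
      ((MonoidHom.id _).prodMap (cmAdelicOneEquivRelNormOne L).symm.toMonoidHom))

/-- **`cmConjLineRepFin₁`**: `cmConjLineRep₁ η₁` in the same currencies. [cite: GelbartRogawski1991, §3.1 Remark p. 457 L4–13] -/
def cmConjLineRepFin₁ :
    Representation ℂ (CMAdelic L dV × ↥(relNormOneIdeles (↥(maximalRealSubfield L)) L))
      (piSchwartzBruhat (↥(maximalRealSubfield L)) (Fin n₁)) :=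
  (piSBReindex (↥(maximalRealSubfield L)) e₁).conjRingEquiv.toMonoidHom.comp
    ((cmConjLineRep₁ L e e₁ dV hdV hdV0 a ha ha0 b hb hb0 g₀ hg₀ hGR hGR₀ hGR₁ η₁).comp
      ((MonoidHom.id _).prodMap (cmAdelicOneEquivRelNormOne L).symm.toMonoidHom))

/-- values of `cmConjLineRepFin₀`: `R_{e₁} (cmConjLineRep₀ η₀ (v, t) (R_{e₁}⁻¹ φ))`. [folklore] -/
theorem cmConjLineRepFin₀_apply (v : CMAdelic L dV) (t : ↥(relNormOneIdeles (↥(maximalRealSubfield L)) L))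
    (φ : piSchwartzBruhat (↥(maximalRealSubfield L)) (Fin n₁)) :
    cmConjLineRepFin₀ L e e₁ dV hdV hdV0 a ha ha0 b hb hb0 g₀ hg₀ hGR hGR₀ hGR₁ η₀ (v, t) φ =
      piSBReindex (↥(maximalRealSubfield L)) e₁
        (cmConjLineRep₀ L e e₁ dV hdV hdV0 a ha ha0 b hb hb0 g₀ hg₀ hGR hGR₀ hGR₁ η₀ (v, (cmAdelicOneEquivRelNormOne L).symm t)
          ((piSBReindex (↥(maximalRealSubfield L)) e₁).symm φ)) :=
  rfl

/-- values of `cmConjLineRepFin₁`. [folklore] -/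
theorem cmConjLineRepFin₁_apply (v : CMAdelic L dV) (t : ↥(relNormOneIdeles (↥(maximalRealSubfield L)) L))
    (φ : piSchwartzBruhat (↥(maximalRealSubfield L)) (Fin n₁)) :
    cmConjLineRepFin₁ L e e₁ dV hdV hdV0 a ha ha0 b hb hb0 g₀ hg₀ hGR hGR₀ hGR₁ η₁ (v, t) φ =
      piSBReindex (↥(maximalRealSubfield L)) e₁
        (cmConjLineRep₁ L e e₁ dV hdV hdV0 a ha ha0 b hb hb0 g₀ hg₀ hGR hGR₀ hGR₁ η₁ (v, (cmAdelicOneEquivRelNormOne L).symm t)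
          ((piSBReindex (↥(maximalRealSubfield L)) e₁).symm φ)) :=
  rfl

/-- **the plane's torus element of a pair of norm-one ideles** `(t₀, t₁) ↦ (g₀ ⊗ 1)·diag(t₀, t₁)·(g₀ ⊗ 1)⁻¹ ∈ U(diag(a₀,a₁))(𝔸)`. [cite: Kudla1984, §1] -/
def cmConjPlaneTorusIdeles :
    ↥(relNormOneIdeles (↥(maximalRealSubfield L)) L) × ↥(relNormOneIdeles (↥(maximalRealSubfield L)) L) →* CMAdelic L a :=
  (cmConjPlaneTorus L a b g₀ hg₀).comp
    ((cmAdelicOneEquivRelNormOne L).symm.toMonoidHom.prodMap (cmAdelicOneEquivRelNormOne L).symm.toMonoidHom)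

/-- unfolding. [folklore] -/
theorem cmConjPlaneTorusIdeles_apply (t₀ t₁ : ↥(relNormOneIdeles (↥(maximalRealSubfield L)) L)) :
    cmConjPlaneTorusIdeles L a b g₀ hg₀ (t₀, t₁) =
      cmConjPlaneTorus L a b g₀ hg₀ ((cmAdelicOneEquivRelNormOne L).symm t₀, (cmAdelicOneEquivRelNormOne L).symm t₁) :=
  rfl

/-- its `GL₂(𝔸_L)` element is `(g₀ ⊗ 1) · diag(t₀, t₁) · (g₀ ⊗ 1)⁻¹` with `diag(t₀, t₁) = cmPlaneTorusIdeles b (t₀, t₁)` (whose matrix is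
`diagonal ![t₀, t₁]`, `val_cmPlaneTorusIdeles`). [cite: Kudla1984, §1] -/
theorem coe_cmConjPlaneTorusIdeles (t₀ t₁ : ↥(relNormOneIdeles (↥(maximalRealSubfield L)) L)) :
    ((cmConjPlaneTorusIdeles L a b g₀ hg₀ (t₀, t₁) : CMAdelic L a) : GL (Fin 2) (AdeleRing (𝓞 L) L)) =
      toAdeleGL L g₀ * ((cmPlaneTorusIdeles L b (t₀, t₁) : CMAdelic L b) : GL (Fin 2) (AdeleRing (𝓞 L) L)) *
        (toAdeleGL L g₀)⁻¹ :=
  coe_cmConjPlaneTorus L a b g₀ hg₀ _ _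

/-- **THE SEE-SAW RESTRICTION, period-packet currencies**: for every split `η(v, g·diag(t₀,t₁)·g⁻¹) = η₀(v,t₀) · η₁(v,t₁)`
(stated on `U(1)(𝔸)`), `v ∈ U(diag dV)(𝔸)`, norm-one ideles `t₀, t₁` and `φ₁, φ₂ ∈ 𝒮(𝔸^{n₁})`,
`(ω_ψ ∘ (s_pair ⊗ η))(v, g·diag(t₀, t₁)·g⁻¹) (φ₁ ⊗″ φ₂) = (cmConjLineRepFin₀ η₀ (v, t₀) φ₁) ⊗″ (cmConjLineRepFin₁ η₁ (v, t₁) φ₂)`.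
[cite: Howe1979, §3; GelbartRogawski1991, §3.1 Remark p. 457 L4–13] -/
theorem cmPairRepTwist_conjTorusIdeles_cmConjLineTensorFin
    (hη : ∀ (v : CMAdelic L dV) (u₀ u₁ : CMAdelicOne L), η (v, cmConjPlaneTorus L a b g₀ hg₀ (u₀, u₁)) = η₀ (v, u₀) * η₁ (v, u₁))
    (v : CMAdelic L dV) (t₀ t₁ : ↥(relNormOneIdeles (↥(maximalRealSubfield L)) L))
    (φ₁ φ₂ : piSchwartzBruhat (↥(maximalRealSubfield L)) (Fin n₁)) :
    cmPairRepTwist L e dV hdV hdV0 a ha ha0 hGR η (v, cmConjPlaneTorusIdeles L a b g₀ hg₀ (t₀, t₁))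
        (cmConjLineTensorFin L e e₁ dV hdV hdV0 a ha ha0 b hb hb0 g₀ hg₀ φ₁ φ₂) =
      cmConjLineTensorFin L e e₁ dV hdV hdV0 a ha ha0 b hb hb0 g₀ hg₀ (cmConjLineRepFin₀ L e e₁ dV hdV hdV0 a ha ha0 b hb hb0 g₀ hg₀ hGR hGR₀ hGR₁ η₀ (v, t₀) φ₁)
        (cmConjLineRepFin₁ L e e₁ dV hdV hdV0 a ha ha0 b hb hb0 g₀ hg₀ hGR hGR₀ hGR₁ η₁ (v, t₁) φ₂) := by
  rw [cmConjLineTensorFin_apply, cmConjLineTensorFin_apply, cmConjLineRepFin₀_apply, cmConjLineRepFin₁_apply,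
    LinearEquiv.symm_apply_apply, LinearEquiv.symm_apply_apply]
  exact cmPairRepTwist_conjTorus_cmConjLineTensor L e e₁ dV hdV hdV0 a ha ha0 b hb hb0 g₀ hg₀ hGR hGR₀ hGR₁ η η₀ η₁ hη v _ _ _ _

/-- the same at the DEFAULT split `η₀ := cmConjEta₀ η`, `η₁ := cmConjEta₁ η ∘ snd`.
[cite: Howe1979, §3; GelbartRogawski1991, §3.1 Remark p. 457 L4–13] -/
theorem cmPairRepTwist_conjTorusIdeles_cmConjLineTensorFin_default (v : CMAdelic L dV)
    (t₀ t₁ : ↥(relNormOneIdeles (↥(maximalRealSubfield L)) L))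
    (φ₁ φ₂ : piSchwartzBruhat (↥(maximalRealSubfield L)) (Fin n₁)) :
    cmPairRepTwist L e dV hdV hdV0 a ha ha0 hGR η (v, cmConjPlaneTorusIdeles L a b g₀ hg₀ (t₀, t₁))
        (cmConjLineTensorFin L e e₁ dV hdV hdV0 a ha ha0 b hb hb0 g₀ hg₀ φ₁ φ₂) =
      cmConjLineTensorFin L e e₁ dV hdV hdV0 a ha ha0 b hb hb0 g₀ hg₀
        (cmConjLineRepFin₀ L e e₁ dV hdV hdV0 a ha ha0 b hb hb0 g₀ hg₀ hGR hGR₀ hGR₁ (cmConjEta₀ L dV a b g₀ hg₀ η) (v, t₀) φ₁)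
        (cmConjLineRepFin₁ L e e₁ dV hdV hdV0 a ha ha0 b hb hb0 g₀ hg₀ hGR hGR₀ hGR₁ ((cmConjEta₁ L dV a b g₀ hg₀ η).comp (MonoidHom.snd _ _)) (v, t₁) φ₂) :=
  cmPairRepTwist_conjTorusIdeles_cmConjLineTensorFin L e e₁ dV hdV hdV0 a ha ha0 b hb hb0 g₀ hg₀ hGR hGR₀ hGR₁ η _ _ (cmConjEta_torus L dV a b g₀ hg₀ η) v t₀ t₁ φ₁ φ₂

end Fin

/-! ## §5. The raw line representations fix `Θ` on rational points -/

section Rational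

variable (L : Type) [Field L] [NumberField L] [IsCMField L] {N n n₁ : ℕ}
  (e : Fin N × Fin 2 ≃ Fin n) (e₁ : Fin N × Fin 1 ≃ Fin n₁)
variable (dV : Fin N → L) (hdV : ∀ i, IsCMField.complexConj L (dV i) = dV i) (hdV0 : ∀ i, dV i ≠ 0)
variable (a : Fin 2 → L) (ha : ∀ i, IsCMField.complexConj L (a i) = a i) (ha0 : ∀ i, a i ≠ 0)
variable (b : Fin 2 → L) (hb : ∀ i, IsCMField.complexConj L (b i) = b i) (hb0 : ∀ i, b i ≠ 0) (g₀ : GL (Fin 2) L)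
  (hg₀ : ((g₀ : Matrix (Fin 2) (Fin 2) L).map (IsCMField.complexConj L : L →+* L))ᵀ * Matrix.diagonal a *
    (g₀ : Matrix (Fin 2) (Fin 2) L) = Matrix.diagonal b)
variable (hGR : (cmSplittingDatum L e dV hdV hdV0 a ha ha0).CompatibleSplitting)
  (hGR₀ : (cmSplittingDatum L e₁ dV hdV hdV0 (lineVec L (b 0)) (fun _ => hb 0) (fun _ => hb0 0)).CompatibleSplitting)
  (hGR₁ : (cmSplittingDatum L e₁ dV hdV hdV0 (lineVec L (b 1)) (fun _ => hb 1) (fun _ => hb0 1)).CompatibleSplitting)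

/-- **`ω₀″(γ_U, γ)` fixes `Θ`** for rational `γ_U ∈ U(diag dV)(L⁺)`, `γ ∈ U(⟨b₀⟩)(L⁺)`.
[cite: Weil1964, Chap. III n° 41 Thm 6 p. 193] -/
theorem cmConjLineRepRaw₀_toHomUnits_mem_thetaStabilizer {v : CMAdelic L dV} (hv : v ∈ CMRat L dV)
    {u : CMAdelic L (lineVec L (b 0))} (hu : u ∈ CMRat L (lineVec L (b 0))) :
    (cmConjLineRepRaw₀ L e e₁ dV hdV hdV0 a ha ha0 b hb hb0 g₀ hg₀ hGR hGR₀ hGR₁).toHomUnits (v, u) ∈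
      thetaStabilizer (↥(maximalRealSubfield L)) (Fin N × Fin 1) :=
  seesawConjRep₁_toHomUnits_mem_thetaStabilizer (↥(maximalRealSubfield L)) L (IsCMField.complexConj L) N 1 1 e e₁ e₁
    (Matrix.diagonal dV) (Matrix.diagonal a) (Matrix.diagonal (lineVec L (b 0))) (Matrix.diagonal (lineVec L (b 1)))
    (complexConj_imagUnit L) (imagUnit_ne_zero L) (imagUnit_mul_self L)
    (realDiagonal_isSymm L dV hdV) (realDiagonal_isSymm L a ha)
    (realDiagonal_isSymm L (lineVec L (b 0)) fun _ => hb 0) (realDiagonal_isSymm L (lineVec L (b 1)) fun _ => hb 1)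
    (isUnit_det_realDiagonal L dV hdV hdV0) (isUnit_det_realDiagonal L a ha ha0)
    (isUnit_det_realDiagonal L (lineVec L (b 0)) (fun _ => hb 0) fun _ => hb0 0)
    (isUnit_det_realDiagonal L (lineVec L (b 1)) (fun _ => hb 1) fun _ => hb0 1)
    ((Matrix.isUnit_iff_isUnit_det _).1
      (isUnit_kronecker_map (↥(maximalRealSubfield L)) N (isUnit_det_realDiagonal L dV hdV hdV0)
        (isUnit_det_realDiagonal L a ha ha0)))
    (realDiagonal_map L dV hdV).symm (realDiagonal_map L a ha).symm
    (realDiagonal_map L (lineVec L (b 0)) fun _ => hb 0).symm (realDiagonal_map L (lineVec L (b 1)) fun _ => hb 1).symm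
    (val_toAdeleGL L g₀) (adelicIsometry_conj L a b g₀ hg₀)
    (coe_gramConj L a ha ha0 b hb hb0)
    (gramIntertwiner_conj L a ha ha0 b hb hb0 (realDiagonal L dV hdV))
    (splittingOf_isCompatible _ _ _ _ _ _ _ _ _ _ _ _ _ _ _ _ _ hGR)
    (splittingOf_isCompatible _ _ _ _ _ _ _ _ _ _ _ _ _ _ _ _ _ hGR₀)
    (splittingOf_isCompatible _ _ _ _ _ _ _ _ _ _ _ _ _ _ _ _ _ hGR₁) (ratIsometry_conj L a b g₀ hg₀) hv hu

/-- **`ω₁″(γ_U, γ)` fixes `Θ`** for rational `γ_U ∈ U(diag dV)(L⁺)`, `γ ∈ U(⟨b₁⟩)(L⁺)`.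
[cite: Weil1964, Chap. III n° 41 Thm 6 p. 193] -/
theorem cmConjLineRepRaw₁_toHomUnits_mem_thetaStabilizer {v : CMAdelic L dV} (hv : v ∈ CMRat L dV)
    {u : CMAdelic L (lineVec L (b 1))} (hu : u ∈ CMRat L (lineVec L (b 1))) :
    (cmConjLineRepRaw₁ L e e₁ dV hdV hdV0 a ha ha0 b hb hb0 g₀ hg₀ hGR hGR₀ hGR₁).toHomUnits (v, u) ∈
      thetaStabilizer (↥(maximalRealSubfield L)) (Fin N × Fin 1) :=
  seesawConjRep₂_toHomUnits_mem_thetaStabilizer (↥(maximalRealSubfield L)) L (IsCMField.complexConj L) N 1 1 e e₁ e₁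
    (Matrix.diagonal dV) (Matrix.diagonal a) (Matrix.diagonal (lineVec L (b 0))) (Matrix.diagonal (lineVec L (b 1)))
    (complexConj_imagUnit L) (imagUnit_ne_zero L) (imagUnit_mul_self L)
    (realDiagonal_isSymm L dV hdV) (realDiagonal_isSymm L a ha)
    (realDiagonal_isSymm L (lineVec L (b 0)) fun _ => hb 0) (realDiagonal_isSymm L (lineVec L (b 1)) fun _ => hb 1)
    (isUnit_det_realDiagonal L dV hdV hdV0) (isUnit_det_realDiagonal L a ha ha0)
    (isUnit_det_realDiagonal L (lineVec L (b 0)) (fun _ => hb 0) fun _ => hb0 0)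
    (isUnit_det_realDiagonal L (lineVec L (b 1)) (fun _ => hb 1) fun _ => hb0 1)
    ((Matrix.isUnit_iff_isUnit_det _).1
      (isUnit_kronecker_map (↥(maximalRealSubfield L)) N (isUnit_det_realDiagonal L dV hdV hdV0)
        (isUnit_det_realDiagonal L a ha ha0)))
    (realDiagonal_map L dV hdV).symm (realDiagonal_map L a ha).symm
    (realDiagonal_map L (lineVec L (b 0)) fun _ => hb 0).symm (realDiagonal_map L (lineVec L (b 1)) fun _ => hb 1).symm
    (val_toAdeleGL L g₀) (adelicIsometry_conj L a b g₀ hg₀)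
    (coe_gramConj L a ha ha0 b hb hb0)
    (gramIntertwiner_conj L a ha ha0 b hb hb0 (realDiagonal L dV hdV))
    (splittingOf_isCompatible _ _ _ _ _ _ _ _ _ _ _ _ _ _ _ _ _ hGR)
    (splittingOf_isCompatible _ _ _ _ _ _ _ _ _ _ _ _ _ _ _ _ _ hGR₀)
    (splittingOf_isCompatible _ _ _ _ _ _ _ _ _ _ _ _ _ _ _ _ _ hGR₁) (ratIsometry_conj L a b g₀ hg₀) hv hu

end Rational

/-! ## §6 Junction with the `adelicUnitaryGroup` currency (the period packet's CONJUGATED torus embedding) -/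

section Junction

variable (L : Type) [Field L] [NumberField L] [IsCMField L] {N n n₁ : ℕ}
  (e : Fin N × Fin 2 ≃ Fin n) (e₁ : Fin N × Fin 1 ≃ Fin n₁)
variable (dV : Fin N → L) (hdV : ∀ i, IsCMField.complexConj L (dV i) = dV i) (hdV0 : ∀ i, dV i ≠ 0)
variable (a : Fin 2 → L) (ha : ∀ i, IsCMField.complexConj L (a i) = a i) (ha0 : ∀ i, a i ≠ 0)
variable (b : Fin 2 → L) (hb : ∀ i, IsCMField.complexConj L (b i) = b i) (hb0 : ∀ i, b i ≠ 0) (g₀ : GL (Fin 2) L)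
  (hg₀ : ((g₀ : Matrix (Fin 2) (Fin 2) L).map (IsCMField.complexConj L : L →+* L))ᵀ * Matrix.diagonal a *
    (g₀ : Matrix (Fin 2) (Fin 2) L) = Matrix.diagonal b)
variable (hGR : (cmSplittingDatum L e dV hdV hdV0 a ha ha0).CompatibleSplitting)
variable (hGR₀ : (cmSplittingDatum L e₁ dV hdV hdV0 (lineVec L (b 0)) (fun _ => hb 0) (fun _ => hb0 0)).CompatibleSplitting)
variable (hGR₁ : (cmSplittingDatum L e₁ dV hdV hdV0 (lineVec L (b 1)) (fun _ => hb 1) (fun _ => hb0 1)).CompatibleSplitting)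
variable (η : CMAdelic L dV × CMAdelic L a →* ℂˣ) (η₀ η₁ : CMAdelic L dV × CMAdelicOne L →* ℂˣ)

/-- **Junction**: an element `x ∈ U(diag a)(𝔸_{L⁺})` (the `adelicUnitaryGroup` currency of `AdelicUnitaryGroup`) with
`x = (g₀ ⊗ 1) · d · (g₀ ⊗ 1)⁻¹` in `GL₂(𝔸_L)` for a `d` whose matrix is `diag(t₀, t₁)`, `t₀, t₁` norm-one ideles, is carried by the CM
carrier bridge `cmAdelicEquiv` (the identity on matrices) to `cmConjPlaneTorusIdeles (t₀, t₁)`.  (Consumer: the period packet's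
CONJUGATED torus embedding `t ↦ isoGL · diag(t₀, t₁) · isoGL⁻¹ ∈ U(W)(𝔸)` of the lines `2, 3`, whose defining properties are exactly
`hx`, `hd`.) [folklore] -/
theorem cmAdelicEquiv_eq_cmConjPlaneTorusIdeles (x : ↥(adelicUnitaryGroup L (Matrix.diagonal a)))
    (d : GL (Fin 2) (AdeleRing (𝓞 L) L)) (t₀ t₁ : ↥(relNormOneIdeles (↥(maximalRealSubfield L)) L))
    (hd : (d : Matrix (Fin 2) (Fin 2) (AdeleRing (𝓞 L) L)) =
      Matrix.diagonal ![((t₀ : (AdeleRing (𝓞 L) L)ˣ) : AdeleRing (𝓞 L) L), ((t₁ : (AdeleRing (𝓞 L) L)ˣ) : AdeleRing (𝓞 L) L)])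
    (hx : (x : GL (Fin 2) (AdeleRing (𝓞 L) L)) = toAdeleGL L g₀ * d * (toAdeleGL L g₀)⁻¹) :
    cmAdelicEquiv L 2 (Matrix.diagonal a) x = cmConjPlaneTorusIdeles L a b g₀ hg₀ (t₀, t₁) :=
  Subtype.ext (hx.trans (by
    rw [coe_cmConjPlaneTorusIdeles]
    exact congrArg (fun y => toAdeleGL L g₀ * y * (toAdeleGL L g₀)⁻¹)
      (Units.ext (hd.trans (val_cmPlaneTorusIdeles L b t₀ t₁).symm))))

/-- the same, read through `MonoidHom`s: for a hom `j : T →* U(diag a)(𝔸)` with `j t = (g₀ ⊗ 1) · d t · (g₀ ⊗ 1)⁻¹`, `d t` of matrix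
`diag(t₀ t, t₁ t)`, `cmAdelicEquiv ∘ j = cmConjPlaneTorusIdeles ∘ (t₀, t₁)`. [folklore] -/
theorem cmAdelicEquiv_comp_eq_cmConjPlaneTorusIdeles {T : Type*} [Monoid T]
    (j : T →* ↥(adelicUnitaryGroup L (Matrix.diagonal a))) (d : T →* GL (Fin 2) (AdeleRing (𝓞 L) L))
    (t₀ t₁ : T →* ↥(relNormOneIdeles (↥(maximalRealSubfield L)) L))
    (hd : ∀ t : T, ((d t : GL (Fin 2) (AdeleRing (𝓞 L) L)) : Matrix (Fin 2) (Fin 2) (AdeleRing (𝓞 L) L)) =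
      Matrix.diagonal ![((t₀ t : (AdeleRing (𝓞 L) L)ˣ) : AdeleRing (𝓞 L) L), ((t₁ t : (AdeleRing (𝓞 L) L)ˣ) : AdeleRing (𝓞 L) L)])
    (hj : ∀ t : T, ((j t : GL (Fin 2) (AdeleRing (𝓞 L) L))) = toAdeleGL L g₀ * d t * (toAdeleGL L g₀)⁻¹) (t : T) :
    (cmAdelicEquiv L 2 (Matrix.diagonal a)).toMonoidHom.comp j t = cmConjPlaneTorusIdeles L a b g₀ hg₀ (t₀ t, t₁ t) :=
  cmAdelicEquiv_eq_cmConjPlaneTorusIdeles L a b g₀ hg₀ (j t) (d t) (t₀ t) (t₁ t) (hd t) (hj t)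

/-- **THE SEE-SAW RESTRICTION along the conjugated torus embedding of the period packet**: for
`x = (g₀ ⊗ 1) · diag(t₀, t₁) · (g₀ ⊗ 1)⁻¹ ∈ U(diag a)(𝔸_{L⁺})` (in the `adelicUnitaryGroup` currency), `v ∈ U(diag dV)(𝔸)` and
`φ₁, φ₂ ∈ 𝒮(𝔸^{n₁})`,
`(ω_ψ ∘ (s_pair ⊗ η))(v, cmAdelicEquiv x) (φ₁ ⊗″ φ₂) = (cmConjLineRepFin₀ η₀ (v, t₀) φ₁) ⊗″ (cmConjLineRepFin₁ η₁ (v, t₁) φ₂)`.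
[cite: Howe1979, §3; Kudla1984, §1; GelbartRogawski1991, §3.1 Remark p. 457 L4–13] -/
theorem cmPairRepTwist_cmAdelicEquiv_cmConjLineTensorFin
    (hη : ∀ (v : CMAdelic L dV) (u₀ u₁ : CMAdelicOne L),
      η (v, cmConjPlaneTorus L a b g₀ hg₀ (u₀, u₁)) = η₀ (v, u₀) * η₁ (v, u₁))
    (v : CMAdelic L dV) (x : ↥(adelicUnitaryGroup L (Matrix.diagonal a))) (d : GL (Fin 2) (AdeleRing (𝓞 L) L))
    (t₀ t₁ : ↥(relNormOneIdeles (↥(maximalRealSubfield L)) L))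
    (hd : (d : Matrix (Fin 2) (Fin 2) (AdeleRing (𝓞 L) L)) =
      Matrix.diagonal ![((t₀ : (AdeleRing (𝓞 L) L)ˣ) : AdeleRing (𝓞 L) L), ((t₁ : (AdeleRing (𝓞 L) L)ˣ) : AdeleRing (𝓞 L) L)])
    (hx : (x : GL (Fin 2) (AdeleRing (𝓞 L) L)) = toAdeleGL L g₀ * d * (toAdeleGL L g₀)⁻¹)
    (φ₁ φ₂ : piSchwartzBruhat (↥(maximalRealSubfield L)) (Fin n₁)) :
    cmPairRepTwist L e dV hdV hdV0 a ha ha0 hGR η (v, cmAdelicEquiv L 2 (Matrix.diagonal a) x)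
        (cmConjLineTensorFin L e e₁ dV hdV hdV0 a ha ha0 b hb hb0 g₀ hg₀ φ₁ φ₂) =
      cmConjLineTensorFin L e e₁ dV hdV hdV0 a ha ha0 b hb hb0 g₀ hg₀
        (cmConjLineRepFin₀ L e e₁ dV hdV hdV0 a ha ha0 b hb hb0 g₀ hg₀ hGR hGR₀ hGR₁ η₀ (v, t₀) φ₁)
        (cmConjLineRepFin₁ L e e₁ dV hdV hdV0 a ha ha0 b hb hb0 g₀ hg₀ hGR hGR₀ hGR₁ η₁ (v, t₁) φ₂) := by
  rw [cmAdelicEquiv_eq_cmConjPlaneTorusIdeles L a b g₀ hg₀ x d t₀ t₁ hd hx]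
  exact cmPairRepTwist_conjTorusIdeles_cmConjLineTensorFin L e e₁ dV hdV hdV0 a ha ha0 b hb hb0 g₀ hg₀ hGR hGR₀ hGR₁ η η₀ η₁ hη
    v t₀ t₁ φ₁ φ₂

/-- default instance of `cmPairRepTwist_cmAdelicEquiv_cmConjLineTensorFin` (`η₀ := cmConjEta₀ η`, `η₁ := cmConjEta₁ η ∘ pr₂`). [folklore] -/
theorem cmPairRepTwist_cmAdelicEquiv_cmConjLineTensorFin_default
    (v : CMAdelic L dV) (x : ↥(adelicUnitaryGroup L (Matrix.diagonal a))) (d : GL (Fin 2) (AdeleRing (𝓞 L) L))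
    (t₀ t₁ : ↥(relNormOneIdeles (↥(maximalRealSubfield L)) L))
    (hd : (d : Matrix (Fin 2) (Fin 2) (AdeleRing (𝓞 L) L)) =
      Matrix.diagonal ![((t₀ : (AdeleRing (𝓞 L) L)ˣ) : AdeleRing (𝓞 L) L), ((t₁ : (AdeleRing (𝓞 L) L)ˣ) : AdeleRing (𝓞 L) L)])
    (hx : (x : GL (Fin 2) (AdeleRing (𝓞 L) L)) = toAdeleGL L g₀ * d * (toAdeleGL L g₀)⁻¹)
    (φ₁ φ₂ : piSchwartzBruhat (↥(maximalRealSubfield L)) (Fin n₁)) :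
    cmPairRepTwist L e dV hdV hdV0 a ha ha0 hGR η (v, cmAdelicEquiv L 2 (Matrix.diagonal a) x)
        (cmConjLineTensorFin L e e₁ dV hdV hdV0 a ha ha0 b hb hb0 g₀ hg₀ φ₁ φ₂) =
      cmConjLineTensorFin L e e₁ dV hdV hdV0 a ha ha0 b hb hb0 g₀ hg₀
        (cmConjLineRepFin₀ L e e₁ dV hdV hdV0 a ha ha0 b hb hb0 g₀ hg₀ hGR hGR₀ hGR₁ (cmConjEta₀ L dV a b g₀ hg₀ η) (v, t₀) φ₁)
        (cmConjLineRepFin₁ L e e₁ dV hdV hdV0 a ha ha0 b hb hb0 g₀ hg₀ hGR hGR₀ hGR₁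
          ((cmConjEta₁ L dV a b g₀ hg₀ η).comp (MonoidHom.snd _ _)) (v, t₁) φ₂) := by
  rw [cmAdelicEquiv_eq_cmConjPlaneTorusIdeles L a b g₀ hg₀ x d t₀ t₁ hd hx]
  exact cmPairRepTwist_conjTorusIdeles_cmConjLineTensorFin_default L e e₁ dV hdV hdV0 a ha ha0 b hb hb0 g₀ hg₀ hGR hGR₀ hGR₁ η
    v t₀ t₁ φ₁ φ₂

/-- **THE SEE-SAW IDENTITY AT Θ-VALUE LEVEL** (binder-1's `SeesawHyp34.seesaw`): for `x = (g₀ ⊗ 1) · diag(t₀, t₁) · (g₀ ⊗ 1)⁻¹`,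
`Θ((ω_ψ ∘ (s_pair ⊗ η))(v, cmAdelicEquiv x) (φ₁ ⊗″ φ₂)) = Θ(cmConjLineRepFin₀ η₀ (v, t₀) φ₁) · Θ(cmConjLineRepFin₁ η₁ (v, t₁) φ₂)`.
[cite: Howe1979, §3; Weil1964, Chap. III n° 41 Thm 6 p. 193] -/
theorem thetaDistLM_cmPairRepTwist_cmAdelicEquiv_cmConjLineTensorFin
    (hη : ∀ (v : CMAdelic L dV) (u₀ u₁ : CMAdelicOne L),
      η (v, cmConjPlaneTorus L a b g₀ hg₀ (u₀, u₁)) = η₀ (v, u₀) * η₁ (v, u₁))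
    (v : CMAdelic L dV) (x : ↥(adelicUnitaryGroup L (Matrix.diagonal a))) (d : GL (Fin 2) (AdeleRing (𝓞 L) L))
    (t₀ t₁ : ↥(relNormOneIdeles (↥(maximalRealSubfield L)) L))
    (hd : (d : Matrix (Fin 2) (Fin 2) (AdeleRing (𝓞 L) L)) =
      Matrix.diagonal ![((t₀ : (AdeleRing (𝓞 L) L)ˣ) : AdeleRing (𝓞 L) L), ((t₁ : (AdeleRing (𝓞 L) L)ˣ) : AdeleRing (𝓞 L) L)])
    (hx : (x : GL (Fin 2) (AdeleRing (𝓞 L) L)) = toAdeleGL L g₀ * d * (toAdeleGL L g₀)⁻¹)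
    (φ₁ φ₂ : piSchwartzBruhat (↥(maximalRealSubfield L)) (Fin n₁)) :
    thetaDistLM (↥(maximalRealSubfield L)) (Fin n)
        (cmPairRepTwist L e dV hdV hdV0 a ha ha0 hGR η (v, cmAdelicEquiv L 2 (Matrix.diagonal a) x)
          (cmConjLineTensorFin L e e₁ dV hdV hdV0 a ha ha0 b hb hb0 g₀ hg₀ φ₁ φ₂)) =
      thetaDistLM (↥(maximalRealSubfield L)) (Fin n₁)
          (cmConjLineRepFin₀ L e e₁ dV hdV hdV0 a ha ha0 b hb hb0 g₀ hg₀ hGR hGR₀ hGR₁ η₀ (v, t₀) φ₁) *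
        thetaDistLM (↥(maximalRealSubfield L)) (Fin n₁)
          (cmConjLineRepFin₁ L e e₁ dV hdV hdV0 a ha ha0 b hb hb0 g₀ hg₀ hGR hGR₀ hGR₁ η₁ (v, t₁) φ₂) := by
  rw [cmPairRepTwist_cmAdelicEquiv_cmConjLineTensorFin L e e₁ dV hdV hdV0 a ha ha0 b hb hb0 g₀ hg₀ hGR hGR₀ hGR₁ η η₀ η₁ hη v x d
    t₀ t₁ hd hx, thetaDistLM_cmConjLineTensorFin]

end Junction

/-! ### Build-lane note (ops-buildfix G11b-3 recipe, LEDGER B13-1, 2026-08-21)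
`lean -o` (the hub build lane, never `lean`/the gate check) runs Lean 4.32's library-suggestion indexers
(`Lean.LibrarySuggestions.SymbolFrequency` / `SineQuaNon`, from their `exportEntriesFn`) over the statement of
every local theorem that is not a denied premise; on this family's statements (very large dependent binder
telescopes through the theta-kernel / dual-pair data) that fold runs for tens of minutes to hours and the build
lane kills the job (incident G11b-3, run/shared/lean/ops/buildfix/G11b-3-DOSSIER.md). `isDeniedPremise` skips
`[implicit_reducible]` constants before any fold, and a reducibility status on a *theorem* is inert (Meta never
unfolds `thmInfo`; the kernel ignores the attribute), so the public theorems of this file are tagged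
`[implicit_reducible]` purely to keep them out of that index. Only other effect: they are not offered by
`+suggestions` premise selectors. No statement or proof is changed; superseded if the operator lands a
deny-list form (`HarnessLib.PremiseIndex`). -/
set_option allowUnsafeReducibility true in
attribute [implicit_reducible]
  ratIsometry_conj adelicIsometry_conj kronecker_map' realDiagonal_mul_diagonal_conjScale
  isUnit_one_kronecker_diagonal_conjScale coe_gramConj₀ coe_gramConj gramIntertwiner_conj
  cmPairRep_conjBlockDiag_cmConjLineTensor thetaDistLM_cmConjLineTensor cmConjPlaneTorus_apply
  coe_cmConjPlaneTorus cmConjPlaneTorus_eq_inl_mul_inr cmConjEta_torus cmConjLineRep₀_apply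
  cmConjLineRep₁_apply cmPairRepTwist_conjTorus_cmConjLineTensor
  cmPairRepTwist_conjTorus_cmConjLineTensor_default cmConjLineTensorFin_apply
  thetaDistLM_cmConjLineTensorFin cmConjLineRepFin₀_apply cmConjLineRepFin₁_apply
  cmConjPlaneTorusIdeles_apply coe_cmConjPlaneTorusIdeles
  cmPairRepTwist_conjTorusIdeles_cmConjLineTensorFin
  cmPairRepTwist_conjTorusIdeles_cmConjLineTensorFin_default
  cmConjLineRepRaw₀_toHomUnits_mem_thetaStabilizer cmConjLineRepRaw₁_toHomUnits_mem_thetaStabilizer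
  cmAdelicEquiv_eq_cmConjPlaneTorusIdeles cmAdelicEquiv_comp_eq_cmConjPlaneTorusIdeles
  cmPairRepTwist_cmAdelicEquiv_cmConjLineTensorFin
  cmPairRepTwist_cmAdelicEquiv_cmConjLineTensorFin_default
  thetaDistLM_cmPairRepTwist_cmAdelicEquiv_cmConjLineTensorFin

end UnitaryDualPair

end Literature.NumberTheory.GelbartRogawski1991

end
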